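import Mathlib
import Summits.Ventures.PercRepro.TriangleCapAdjPairsEven

/-!
# PercRepro — A VERTEX HUNG ON AN EDGE: `hangEdge D x y` on `Fin (n + 1)` is `D` plus a new vertex adjacent
exactly to `x` and `y` — the dual of `delEdge` (p3, gen 43; part 188)

The one-triangle family of the stability table (§10bt(d), §10bu(c)) is `K_{a,k−a−1}` minus a star plus a vertex
on an edge. `hangEdge D x y` adds the vertex `Fin.last n` to a graph `D` on `Fin n` with the two edges to
`x` and `y`: the degrees rise by one at `x` and `y` and the new vertex has degree `2` (`deg_hangEdge_castSucc`,
`deg_hangEdge_last`), the edge count by `2` (`card_edges_hangEdge`), `Σ_v d(v)²` by `2 (d(x) + d(y)) + 6`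
(`sum_deg_sq_hangEdge`); when `D` is `K₄⁻`-free, `x ∼ y` and `x, y` have no common neighbour the result is
`K₄⁻`-free (`k4mFree_hangEdge`, through `k4mFree_of_common_le_one`); and it carries the triangle
`{last, x, y}`, so it is a spanning subgraph of no `K(A, Aᶜ)` (`not_bipSub_hangEdge`). Axioms: standard.
-/

namespace PercRepro

namespace TriangleCap

namespace C047

open Finset

/-- `D` on `Fin n` plus the vertex `Fin.last n`, adjacent exactly to `x` and `y` (cast up). -/
def hangEdge {n : ℕ} (D : SimpleGraph (Fin n)) (x y : Fin n) : SimpleGraph (Fin (n + 1)) where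
  Adj i j := if h : i.val < n ∧ j.val < n then D.Adj ⟨i.val, h.1⟩ ⟨j.val, h.2⟩
    else (i.val = n ∧ (j.val = x.val ∨ j.val = y.val)) ∨ (j.val = n ∧ (i.val = x.val ∨ i.val = y.val))
  symm := ⟨fun i j h => by
    by_cases hij : i.val < n ∧ j.val < n
    · rw [dif_pos hij] at h
      rw [dif_pos ⟨hij.2, hij.1⟩]
      exact D.adj_symm h
    · rw [dif_neg hij] at h
      rw [dif_neg (fun h' => hij ⟨h'.2, h'.1⟩)]
      tauto⟩
  loopless := ⟨fun i h => by
    by_cases hi : i.val < n ∧ i.val < n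
    · rw [dif_pos hi] at h
      exact D.irrefl h
    · rw [dif_neg hi] at h
      have hx := x.isLt
      have hy := y.isLt
      omega⟩

/-- Adjacency in `hangEdge`, unfolded. -/
theorem hangEdge_adj {n : ℕ} (D : SimpleGraph (Fin n)) (x y : Fin n) (i j : Fin (n + 1)) :
    (hangEdge D x y).Adj i j ↔ (if h : i.val < n ∧ j.val < n then D.Adj ⟨i.val, h.1⟩ ⟨j.val, h.2⟩
      else (i.val = n ∧ (j.val = x.val ∨ j.val = y.val)) ∨ (j.val = n ∧ (i.val = x.val ∨ i.val = y.val))) :=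
  Iff.rfl

/-- Adjacency between two old vertices. -/
theorem hangEdge_adj_of_lt {n : ℕ} (D : SimpleGraph (Fin n)) (x y : Fin n) {i j : Fin (n + 1)}
    (h : i.val < n ∧ j.val < n) : (hangEdge D x y).Adj i j ↔ D.Adj ⟨i.val, h.1⟩ ⟨j.val, h.2⟩ := by
  rw [hangEdge_adj, dif_pos h]

/-- Adjacency when one of the vertices is new. -/
theorem hangEdge_adj_of_not_lt {n : ℕ} (D : SimpleGraph (Fin n)) (x y : Fin n) {i j : Fin (n + 1)}
    (h : ¬ (i.val < n ∧ j.val < n)) : (hangEdge D x y).Adj i j ↔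
      (i.val = n ∧ (j.val = x.val ∨ j.val = y.val)) ∨ (j.val = n ∧ (i.val = x.val ∨ i.val = y.val)) := by
  rw [hangEdge_adj, dif_neg h]

/-- Adjacency in `hangEdge` is decidable. -/
instance decidableRelHangEdge {n : ℕ} (D : SimpleGraph (Fin n)) [DecidableRel D.Adj] (x y : Fin n) :
    DecidableRel (hangEdge D x y).Adj := fun i j =>
  if h : i.val < n ∧ j.val < n then decidable_of_iff _ (hangEdge_adj_of_lt D x y h).symm
  else decidable_of_iff _ (hangEdge_adj_of_not_lt D x y h).symm

/-- Two old vertices are adjacent in `hangEdge` iff they are adjacent in `D`. -/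
theorem hangEdge_adj_castSucc {n : ℕ} (D : SimpleGraph (Fin n)) (x y : Fin n) (i j : Fin n) :
    (hangEdge D x y).Adj i.castSucc j.castSucc ↔ D.Adj i j :=
  hangEdge_adj_of_lt D x y ⟨i.isLt, j.isLt⟩

/-- The new vertex is adjacent exactly to `x` and `y`. -/
theorem hangEdge_adj_last_castSucc {n : ℕ} (D : SimpleGraph (Fin n)) (x y : Fin n) (j : Fin n) :
    (hangEdge D x y).Adj (Fin.last n) j.castSucc ↔ j = x ∨ j = y := by
  rw [hangEdge_adj_of_not_lt D x y (by simp)]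
  have hj := j.isLt
  have hx := x.isLt
  have hy := y.isLt
  simp only [Fin.val_last, Fin.val_castSucc, Fin.ext_iff, true_and]
  constructor
  · intro h
    omega
  · intro h
    omega

/-- `x` and `y` are adjacent to the new vertex. -/
theorem hangEdge_adj_castSucc_last {n : ℕ} (D : SimpleGraph (Fin n)) (x y : Fin n) (j : Fin n) :
    (hangEdge D x y).Adj j.castSucc (Fin.last n) ↔ j = x ∨ j = y := by
  rw [(hangEdge D x y).adj_comm, hangEdge_adj_last_castSucc]

/-- **THE DEGREES OF THE OLD VERTICES:** one more at `x` and at `y`, unchanged elsewhere. -/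
theorem deg_hangEdge_castSucc {n : ℕ} (D : SimpleGraph (Fin n)) [DecidableRel D.Adj] (x y : Fin n) (v : Fin n) :
    deg (hangEdge D x y) v.castSucc = deg D v + (if v = x ∨ v = y then 1 else 0) := by
  unfold deg
  rw [card_filter, card_filter, Fin.sum_univ_castSucc]
  congr 1
  · apply sum_congr rfl
    intro j _
    simp only [hangEdge_adj_castSucc]
  · simp only [hangEdge_adj_castSucc_last]

/-- The indicator of `{x, y}` sums to `2`. -/
theorem sum_ite_pair {n : ℕ} {x y : Fin n} (hxy : x ≠ y) :
    ∑ v : Fin n, (if v = x ∨ v = y then 1 else 0) = 2 := by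
  rw [← card_filter]
  have : univ.filter (fun j : Fin n => j = x ∨ j = y) = {x, y} := by
    ext j
    simp only [mem_filter, mem_univ, true_and, mem_insert, mem_singleton]
  rw [this, card_pair hxy]

/-- **THE DEGREE OF THE NEW VERTEX** is `2`. -/
theorem deg_hangEdge_last {n : ℕ} (D : SimpleGraph (Fin n)) [DecidableRel D.Adj] {x y : Fin n} (hxy : x ≠ y) :
    deg (hangEdge D x y) (Fin.last n) = 2 := by
  unfold deg
  rw [card_filter, Fin.sum_univ_castSucc]
  have h0 : (if (hangEdge D x y).Adj (Fin.last n) (Fin.last n) then 1 else 0) = 0 :=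
    if_neg (hangEdge D x y).irrefl
  rw [h0, add_zero]
  simp only [hangEdge_adj_last_castSucc]
  exact sum_ite_pair hxy

/-- A function weighted by the indicator of `{x, y}` sums to `f x + f y`. -/
theorem sum_mul_ite_pair {n : ℕ} {x y : Fin n} (hxy : x ≠ y) (f : Fin n → ℕ) :
    ∑ v : Fin n, f v * (if v = x ∨ v = y then 1 else 0) = f x + f y := by
  simp only [mul_ite, mul_one, mul_zero]
  rw [← sum_filter]
  have : univ.filter (fun j : Fin n => j = x ∨ j = y) = {x, y} := by
    ext j
    simp only [mem_filter, mem_univ, true_and, mem_insert, mem_singleton]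
  rw [this, sum_pair hxy]

/-- **THE EDGE COUNT:** two more. -/
theorem card_edges_hangEdge {n : ℕ} (D : SimpleGraph (Fin n)) [DecidableRel D.Adj] {x y : Fin n} (hxy : x ≠ y) :
    (hangEdge D x y).edgeFinset.card = D.edgeFinset.card + 2 := by
  have h1 := sum_deg_eq (hangEdge D x y)
  have h2 := sum_deg_eq D
  rw [Fin.sum_univ_castSucc, deg_hangEdge_last D hxy] at h1
  simp only [deg_hangEdge_castSucc] at h1
  rw [sum_add_distrib, sum_ite_pair hxy] at h1
  omega

/-- **THE DEGREE SQUARES:** `Σ d'² = Σ d² + 2 (d(x) + d(y)) + 6`. -/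
theorem sum_deg_sq_hangEdge {n : ℕ} (D : SimpleGraph (Fin n)) [DecidableRel D.Adj] {x y : Fin n} (hxy : x ≠ y) :
    ∑ v, deg (hangEdge D x y) v * deg (hangEdge D x y) v =
      ∑ v, deg D v * deg D v + 2 * (deg D x + deg D y) + 6 := by
  rw [Fin.sum_univ_castSucc, deg_hangEdge_last D hxy]
  simp only [deg_hangEdge_castSucc]
  have hsq : ∀ v : Fin n, (deg D v + (if v = x ∨ v = y then 1 else 0)) *
      (deg D v + (if v = x ∨ v = y then 1 else 0)) =
      deg D v * deg D v + 2 * (deg D v * (if v = x ∨ v = y then 1 else 0)) +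
        (if v = x ∨ v = y then 1 else 0) := by
    intro v
    split_ifs <;> ring
  simp only [hsq]
  rw [sum_add_distrib, sum_add_distrib, ← mul_sum, sum_mul_ite_pair hxy, sum_ite_pair hxy]

/-- **`K₄⁻`-FREENESS IS PRESERVED** when `x ∼ y` and `x, y` have no common neighbour. -/
theorem k4mFree_hangEdge {n : ℕ} (D : SimpleGraph (Fin n)) [DecidableRel D.Adj] (hK : K4mFree D) {x y : Fin n}
    (hxy : D.Adj x y)
    (hcommon : ∀ w, ¬ (D.Adj x w ∧ D.Adj y w)) : K4mFree (hangEdge D x y) := by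
  apply k4mFree_of_common_le_one
  intro i j hij
  have hne : x ≠ y := D.ne_of_adj hxy
  -- the common neighbours of `i` and `j`
  rcases Fin.eq_castSucc_or_eq_last i with ⟨i', rfl⟩ | rfl
  · rcases Fin.eq_castSucc_or_eq_last j with ⟨j', rfl⟩ | rfl
    · -- two old vertices
      rw [hangEdge_adj_castSucc] at hij
      by_cases hxy' : (i' = x ∧ j' = y) ∨ (i' = y ∧ j' = x)
      · -- the edge `x y`: the only common neighbour is the new vertex
        have hsub : (univ.filter (fun w => (hangEdge D x y).Adj i'.castSucc w)) ∩
            (univ.filter (fun w => (hangEdge D x y).Adj j'.castSucc w)) ⊆ {Fin.last n} := by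
          intro w hw
          rw [mem_inter, mem_filter, mem_filter] at hw
          rw [mem_singleton]
          by_contra hlast
          obtain ⟨w', rfl⟩ := Fin.exists_castSucc_eq.mpr hlast
          simp only [hangEdge_adj_castSucc] at hw
          rcases hxy' with ⟨rfl, rfl⟩ | ⟨rfl, rfl⟩
          · exact hcommon w' ⟨hw.1.2, hw.2.2⟩
          · exact hcommon w' ⟨hw.2.2, hw.1.2⟩
        calc _ ≤ ({Fin.last n} : Finset (Fin (n + 1))).card := card_le_card hsub
          _ = 1 := card_singleton _
      · -- another old edge: the common neighbours are old, and `D` has at most one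
        have hsub : (univ.filter (fun w => (hangEdge D x y).Adj i'.castSucc w)) ∩
            (univ.filter (fun w => (hangEdge D x y).Adj j'.castSucc w)) ⊆
            ((univ.filter (fun w => D.Adj i' w)) ∩ (univ.filter (fun w => D.Adj j' w))).image Fin.castSucc := by
          intro w hw
          rw [mem_inter, mem_filter, mem_filter] at hw
          rcases Fin.eq_castSucc_or_eq_last w with ⟨w', rfl⟩ | rfl
          · simp only [hangEdge_adj_castSucc] at hw
            rw [mem_image]
            exact ⟨w', mem_inter.mpr ⟨mem_filter.mpr ⟨mem_univ _, hw.1.2⟩, mem_filter.mpr ⟨mem_univ _, hw.2.2⟩⟩, rfl⟩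
          · exfalso
            simp only [hangEdge_adj_castSucc_last] at hw
            have h1 := hw.1.2
            have h2 := hw.2.2
            have hne' : i' ≠ j' := D.ne_of_adj hij
            rcases h1 with rfl | rfl <;> rcases h2 with rfl | rfl
            · exact hne' rfl
            · exact hxy' (Or.inl ⟨rfl, rfl⟩)
            · exact hxy' (Or.inr ⟨rfl, rfl⟩)
            · exact hne' rfl
        calc _ ≤ (((univ.filter (fun w => D.Adj i' w)) ∩ (univ.filter (fun w => D.Adj j' w))).image
              Fin.castSucc).card := card_le_card hsub
          _ ≤ ((univ.filter (fun w => D.Adj i' w)) ∩ (univ.filter (fun w => D.Adj j' w))).card := card_image_le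
          _ ≤ 1 := card_inter_le_one_of_adj D hK hij
    · -- `i` old, `j` new: `i ∈ {x, y}`, the common neighbours are the other one
      rw [hangEdge_adj_castSucc_last] at hij
      have hsub : (univ.filter (fun w => (hangEdge D x y).Adj i'.castSucc w)) ∩
          (univ.filter (fun w => (hangEdge D x y).Adj (Fin.last n) w)) ⊆
          {x.castSucc, y.castSucc} \ {i'.castSucc} := by
        intro w hw
        rw [mem_inter, mem_filter, mem_filter] at hw
        rw [mem_sdiff, mem_insert, mem_singleton, mem_singleton]
        rcases Fin.eq_castSucc_or_eq_last w with ⟨w', rfl⟩ | rfl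
        · simp only [hangEdge_adj_last_castSucc, hangEdge_adj_castSucc] at hw
          refine ⟨?_, ?_⟩
          · rcases hw.2.2 with rfl | rfl
            · exact Or.inl rfl
            · exact Or.inr rfl
          · intro h
            rw [Fin.castSucc_inj] at h
            exact D.ne_of_adj hw.1.2 h.symm
        · exfalso
          exact (hangEdge D x y).irrefl hw.2.2
      calc _ ≤ ({x.castSucc, y.castSucc} \ {i'.castSucc} : Finset (Fin (n + 1))).card := card_le_card hsub
        _ ≤ 1 := by
          have hmem : i'.castSucc ∈ ({x.castSucc, y.castSucc} : Finset (Fin (n + 1))) := by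
            rw [mem_insert, mem_singleton]
            rcases hij with rfl | rfl
            · exact Or.inl rfl
            · exact Or.inr rfl
          rw [sdiff_singleton_eq_erase, card_erase_of_mem hmem,
            card_pair (fun h => hne (Fin.castSucc_inj.mp h))]
  · rcases Fin.eq_castSucc_or_eq_last j with ⟨j', rfl⟩ | rfl
    · -- `i` new, `j` old: symmetric
      rw [hangEdge_adj_last_castSucc] at hij
      have hsub : (univ.filter (fun w => (hangEdge D x y).Adj (Fin.last n) w)) ∩
          (univ.filter (fun w => (hangEdge D x y).Adj j'.castSucc w)) ⊆
          {x.castSucc, y.castSucc} \ {j'.castSucc} := by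
        intro w hw
        rw [mem_inter, mem_filter, mem_filter] at hw
        rw [mem_sdiff, mem_insert, mem_singleton, mem_singleton]
        rcases Fin.eq_castSucc_or_eq_last w with ⟨w', rfl⟩ | rfl
        · simp only [hangEdge_adj_last_castSucc, hangEdge_adj_castSucc] at hw
          refine ⟨?_, ?_⟩
          · rcases hw.1.2 with rfl | rfl
            · exact Or.inl rfl
            · exact Or.inr rfl
          · intro h
            rw [Fin.castSucc_inj] at h
            exact D.ne_of_adj hw.2.2 h.symm
        · exfalso
          exact (hangEdge D x y).irrefl hw.1.2
      calc _ ≤ ({x.castSucc, y.castSucc} \ {j'.castSucc} : Finset (Fin (n + 1))).card := card_le_card hsub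
        _ ≤ 1 := by
          have hmem : j'.castSucc ∈ ({x.castSucc, y.castSucc} : Finset (Fin (n + 1))) := by
            rw [mem_insert, mem_singleton]
            rcases hij with rfl | rfl
            · exact Or.inl rfl
            · exact Or.inr rfl
          rw [sdiff_singleton_eq_erase, card_erase_of_mem hmem,
            card_pair (fun h => hne (Fin.castSucc_inj.mp h))]
    · exact absurd hij (hangEdge D x y).irrefl

/-- **THE TRIANGLE `{last, x, y}`:** when `x ∼ y`, `hangEdge D x y` is a spanning subgraph of no `K(A, Aᶜ)`. -/
theorem not_bipSub_hangEdge {n : ℕ} (D : SimpleGraph (Fin n)) {x y : Fin n} (hxy : D.Adj x y)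
    (A : Finset (Fin (n + 1))) : ¬ BipSub (hangEdge D x y) A := by
  intro hA
  have h1 := hA _ _ ((hangEdge_adj_last_castSucc D x y x).mpr (Or.inl rfl))
  have h2 := hA _ _ ((hangEdge_adj_last_castSucc D x y y).mpr (Or.inr rfl))
  have h3 := hA _ _ ((hangEdge_adj_castSucc D x y x y).mpr hxy)
  tauto

end C047

end TriangleCap

end PercRepro
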